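import Summits.CriticalPhenomena.PercolationContinuityZ3.Theorems.Transplant.ProdSkeletonSign
import Summits.CriticalPhenomena.PercolationContinuityZ3.Theorems.Transplant.CayleyNilThreeLetters
import HarnessLib

/-!
# `θ(p_c) = 0` on `X □ Cay(Γ; letters)` for quasi-transitive `X` and nilpotent `Γ` of class `≤ 3` with two sign automorphisms

builds on p205010 (kernel theorem, internal audit signed; external expert review pending).
Lane `prim-bschramm`, seat `prim-bschramm-p4` gen 11 (PART C3 of `P4-GENERAL.md`).  Helper file (`--supports stmt-CriticalPhenomena-4575 --as helper`).

Customers of `CayleySign₂.theta_boxProd_eq_zero_of_le` (file `ProdSkeletonSign`): the class-`≤ 3` letters-only data of `CayleyNilThreeLetters`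
(`NilThreeSigns.SignData`) and the free nilpotent groups `N_{m+2,3}` (`FreeNilThree`), multiplied by ANY connected, locally finite,
bounded-degree, quasi-transitive graph `X` (Cayley or not).
-/

noncomputable section

namespace Summit.CriticalPhenomena.PercolationContinuityZ3.Theorems.Transplant

open SimpleGraph Literature.Probability.LatticeModels Literature.Probability.Percolation
open scoped Classical

variable {W : Type} (X : SimpleGraph W) [X.LocallyFinite] [Countable W]

/-- **`θ_v(p) = 0`, `p ≤ p_c`, on `X □ Cay(Γ; A)`** for every quasi-transitive `X` (connected, locally finite, bounded degree) and every
group `Γ` of class `≤ 3` carrying a `NilThreeSigns.SignData` (letters only).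
builds on p205010 (kernel theorem, internal audit signed; external expert review pending). [cite: BenjaminiSchramm1996, Conj. 4; §2] -/
theorem NilThreeSigns.SignData.theta_boxProd_eq_zero_of_le {Γ : Type} [Group Γ] (T : NilThreeSigns.SignData Γ) (hc : X.Connected)
    {ΔX : ℕ} (hΔ : ∀ u, X.degree u ≤ ΔX) (V₀ : Finset W) (hV₀ : ∀ v : W, ∃ γ : X ≃g X, γ v ∈ V₀) (v : W × Γ) {p : unitInterval}
    (hp : (p : ℝ) ≤ criticalProb (X □ mulCayley (T.A : Set Γ)) v) : theta (X □ mulCayley (T.A : Set Γ)) v p = 0 :=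
  T.cayleySign₂.theta_boxProd_eq_zero_of_le X hc hΔ V₀ hV₀ v hp

/-- **`θ_v(p) = 0`, `p ≤ p_c`, on `X □ Cay(N_{m+2,3}; letters)`** for every quasi-transitive `X` (connected, locally finite, bounded degree)
and every rank `m + 2 ≥ 2`.
builds on p205010 (kernel theorem, internal audit signed; external expert review pending). [cite: BenjaminiSchramm1996, Conj. 4; §2] -/
theorem FreeNilThree.theta_boxProd_eq_zero_of_le (m : ℕ) (hc : X.Connected) {ΔX : ℕ} (hΔ : ∀ u, X.degree u ≤ ΔX) (V₀ : Finset W)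
    (hV₀ : ∀ v : W, ∃ γ : X ≃g X, γ v ∈ V₀) (v : W × FreeNilClass.N m 2) {p : unitInterval}
    (hp : (p : ℝ) ≤ criticalProb (X □ mulCayley (↑(FreeNilClass.AL m 2) : Set (FreeNilClass.N m 2))) v) :
    theta (X □ mulCayley (↑(FreeNilClass.AL m 2) : Set (FreeNilClass.N m 2))) v p = 0 :=
  (FreeNilThree.cayleySign₂ m).theta_boxProd_eq_zero_of_le X hc hΔ V₀ hV₀ v hp

end Summit.CriticalPhenomena.PercolationContinuityZ3.Theorems.Transplant

end
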